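import Literature.MathematicalPhysics.QuantumFieldTheory.Balaban1983to89.B9Thm313WholeLettersCut
import Literature.MathematicalPhysics.QuantumFieldTheory.Balaban1983to89.B9Thm313WholeEntry2HolderCut
import Literature.MathematicalPhysics.QuantumFieldTheory.Balaban1983to89.B9Thm313WholeProbe43RHolderCut
import Literature.MathematicalPhysics.QuantumFieldTheory.Balaban1983to89.B9Thm313WholeL2DerivCut
import Literature.MathematicalPhysics.QuantumFieldTheory.Balaban1983to89.B9Thm313WholeDirL2Z

/-!
# `Balaban1983to89.B9Thm313WholeCutCores` — [B9] Theorem 3.13 (p. 426): the three landed RE-CUT consumers of (3.152)–(3.153) INSTANTIATED AT THE CUT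
# RECORDS `Letters313Zc ∕ Letters313HZc ∕ Letters313L2Pc` (layer «cores» of the N06 LETTERS-SPECIES RE-CUT; sequel of `B9Thm313WholeLettersCut`)

T. Bałaban, *Propagators for lattice gauge theories in a background field*, Commun. Math. Phys. **99** (1985) 389–434 [`Balaban1985BackgroundPropagators`,
"B9"]; [4] = T. Bałaban, *Propagators and renormalization transformations for lattice gauge theories. II*, Commun. Math. Phys. **96** (1984) 223–250
[`Balaban1984PropagatorsII`].  statement-level skeleton of published theorems with citation tags; proofs where landed; nothing here is a claim about
the Yang–Mills mass gap.

THE PRINTED LOCI are those of the three consumers (verbatim there): p. 426 (3.152)–(3.153), Theorem 3.13; p. 423 (3.138); pp. 397–398 (3.42)–(3.46).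

WHY THIS FILE.  The re-cut one-member consumers `B9Thm313WholeEntry2HolderCut.GG_entry2_holderCut_of_letters` ((3.42)₃ of 𝔊),
`B9Thm313WholeProbe43RHolderCut.GG_probe43R_holderCut_of_letters` (right (3.43) member) and `B9Thm313WholeL2DerivCut.GG_l2bd_family3∕5DerivCut`
((3.46)₄∕₅ families) (seat ym-inputs-p04) take their letters as unbundled hypotheses with free constants B_X, B_W, B_WE; the row-21 chain over the cut
RECORDS reads them at the records' constants.  THIS FILE fixes that instantiation once:
* §1 ★ `GG_entry2_of_lettersZc` — fed with `Letters313Zc.gQs1 ∕ c1_1 ∕ q1 ∕ gXH ∕ wGp` (B_X = B_W = B₃) and `Ids3152`; constant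
  `const313c (B₀(1−θc)⁻¹) (B₃(1−θc)⁻¹) B₃ κ_{XH} c` (definitionally the consumer's);
* §2 `constHR313c_le_constH313` (the re-cut right-(3.43) constant is below the parent's `constH313` at the same data — the old summand θ′(A₃B₃c)c is
  dropped —, so the leaves' uniformised (3.43) constant `Cu β` dominates it UNCHANGED), ★ `GG_probe43R_of_lettersZc` — fed with `Letters313Zc.gQs1 ∕
  c1_1 ∕ q1 ∕ gXH` (B_X = B₃), `Letters313HZc.pXQs ∕ pWE` (B_WE = Bx β) and `Ids3152`;
* §3 ★ `GG_l2bd_family3Zc ∕ 5Zc` — fed with `Letters313L2Pc.gQs ∕ c1 ∕ q ∕ ddGQs ∕ vDRDG` resp. `… ∕ vGDRD`; conclusions VERBATIM those of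
  `B9Thm313WholeDirL2Z.GG_l2bd_family3Z ∕ 5Z`.
The other whole-record readers of the Z lineage (entry0 ∕ entry1 ∕ probe43L ∕ input pieces ∕ mixed member — they read only KEPT fields) are re-issued
field-unbundled by seat ym-inputs-p04 g2 (`B9Thm313WholeSupReadersCut`, `…Probe43LCut`, and sequels) and are called by name with the record's
projections in the sequels `…BlocksPairMZCut ∕ …LeafRelZCut ∕ …BlocksPairMBZCut ∕ …LeafCompletePairMBZCut`.

HONEST SCOPE.  Kernel-checked bookkeeping over hypothesis schemas of printed species — nothing of [B9]'s estimates is asserted; count-neutral; N06 NOT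
discharged; one finite lattice at a time — nothing continuum ∕ ℝ⁴ ∕ OS ∕ mass gap ∕ Clay.  Cell `pub-ymgap` (HUMAN RULING D-0062), Track A node N06 [B9],
bundle F7 rows 20–21, seat `pub-ymgap-dag-n06-l` (g19), 2026-08-28.  NEW file; nothing landed is modified.
-/

namespace Literature.MathematicalPhysics.QuantumFieldTheory.Balaban1983to89.B9Thm313WholeCutCores

open Literature.MathematicalPhysics.QuantumFieldTheory.Balaban1983to89
open Finset Filter B6RandomWalk B6RandomWalkHom B9Thm34Ext B9Thm37GlueCor36 B11SectG B9SectDSup B9SectDL2Decay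
open B9Thm37AllNorms B9Thm37AllNormsInstances B9FromB6 B9FromB6ModelSignsOn B9SectBStepWhole B9Thm312Whole B9Thm312WholeLeaf B9Thm312WholeLeft
open B9Thm313Whole B9Thm313WholeLeft B9RWSums343Holder B9Ineq347 B9Thm312WholeClasses B9Thm312WholeL2 B9Thm312WholeBlocksRel B9Thm312WholeBlocksNbr
open B9Thm312WholeHolder B9Thm312WholeHHolder B9Thm313WholeHolder B9Thm313WholeL2G B9Thm313WholeL2GP B9RWSums346SecondDiff B9Thm312WholeDir B9Thm313WholeDir
open B9Thm37Glue B9Thm313WholeZ B9Thm313WholeLeftZ B9Thm313WholeHolderZ B9Thm313WholeRgdFrom3152 B9Thm313WholeL2GZ B9Thm313WholeL2GPZ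
open B9Thm313WholeLettersCut B9Thm313WholeEntry2HolderCut B9Thm313WholeProbe43RHolderCut B9Thm313WholeL2DerivCut

noncomputable section

section OneMember

variable {g : B9.Geometry} {B : B9.Backgrounds} {X Y Z W PX PY P : Type}
variable [Fintype X] [Fintype Y] [Fintype Z] [Fintype W] [Fintype PX] [Fintype PY] [Fintype P] [Fintype g.Site]
variable {R₀ : ℝ} {H₀ : Prop}

/-! ## §1 The sup entry (3.42)₃ of 𝔊 over the cut record -/

omit [Fintype PX] [Fintype PY] [Fintype P] in
/-- ★ **THEOREM 3.13, ENTRY (3.42)₃ FOR 𝔊 OVER THE CUT RECORD** — ✓`B9Thm313WholeEntry2HolderCut.GG_entry2_holderCut_of_letters` fed with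
`Letters313Zc.gQs1 ∕ c1_1 ∕ q1 ∕ gXH ∕ wGp` at B_X = B_W = B₃: |(𝔊∇\*_Uμ)(x)| ≦ C·Lʲη·e^{−ρ′d(y,y′)}|μ| with C = `const313c (B₀(1−θc)⁻¹) (B₃(1−θc)⁻¹) B₃ κ_{XH} c`,
for every ρ′ ≧ 0 with ρ′ + 3σ ≦ ρ (ρ ≦ δ₀, ρ ≦ δ₃, ρ + σ ≦ δ_K); the statement shape of `B9Thm313WholeZ.GG_entry2_of_lettersZ` with `Letters313Zc` and `Ids3152` in
place of `Letters313Z` (NO `rgd1`).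
[cite: Balaban1985BackgroundPropagators, Thm 3.13 p.426 + (3.152)–(3.153) p.426 + (3.138) p.423 + (3.42)–(3.44) pp.397–398; Balaban1984PropagatorsII, (2.52)–(2.56) pp.232–233 + Lemma 2.1 (2.61) p.234] -/
theorem GG_entry2_of_lettersZc (hG : GeoOK g) {𝔬 : Ops g B X Y Z W} {U : B.Cfg}
    {θ B₀ B₃ δ₀ δ₃ δK ρ ρ' σ c : ℝ} (hrow : RowSum (toB6 g R₀ H₀) σ c) (hc : 0 ≤ c)
    (hθ : 0 ≤ θ) (hB₀ : 0 ≤ B₀) (hB₃ : 0 ≤ B₃) (hσ : 0 ≤ σ) (hρ' : 0 ≤ ρ') (hρ'ρ : ρ' + 3 * σ ≤ ρ) (hρS : ρ ≤ δ₀)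
    (hρ₃ : ρ ≤ δ₃) (hρδ : ρ + σ ≤ δK) (hq : θ * c < 1)
    (hK : HasMaj (cNorm R₀ H₀ 𝔬.blk hG.lenle 1) (cNorm R₀ H₀ 𝔬.blk hG.lenle 1) (𝔬.G0 U ∘ₗ (𝔬.Tpi U + 𝔬.T2 U))
      (fun a b => θ * Real.exp (-(δK * g.dist a b))))
    (he2 : HasMajorantHom (g := toB6 g R₀ H₀) 𝔬.blkY 𝔬.blk (𝔬.G0 U ∘ₗ 𝔬.Dstar U)
      (fun a b => B₀ * g.len a * Real.exp (-(δ₀ * g.dist a b))))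
    {wZ : g.Site → ℝ} {hwZ : ∀ y, 0 < wZ y}
    {Gp : B.Cfg → Module.End ℝ (W → ℝ)} {bXH : BlockNorm (toB6 g R₀ H₀) (X → ℝ)}
    (hL : Letters313Zc 𝔬 Gp R₀ H₀ hG wZ hwZ B₃ δ₃ bXH U) (hI : Identities 𝔬 U) (h152 : Ids3152 𝔬 Gp U) :
    HasMajorantHom (g := toB6 g R₀ H₀) 𝔬.blkY 𝔬.blk (𝔬.GG U ∘ₗ 𝔬.Dstar U)
      (fun a b => const313c (B₀ * (1 - θ * c)⁻¹) (B₃ * (1 - θ * c)⁻¹) B₃ bXH.κ c * g.len a *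
        Real.exp (-(ρ' * g.dist a b))) :=
  GG_entry2_holderCut_of_letters (hwZ := hwZ) hG hrow hc hθ hB₀ hB₃ hB₃ hB₃ hσ hρ' hρ'ρ hρS hρ₃ hρδ hq hK he2 hL.gQs1 hL.c1_1 hL.q1 hL.gXH hL.wGp
    hI h152

/-! ## §2 The right (3.43) probe majorant of 𝔊 over the cut records -/

omit [Fintype X] [Fintype Y] [Fintype Z] [Fintype W] [Fintype PX] [Fintype PY] [Fintype P] [Fintype g.Site] in
/-- **THE CONSTANT OF THE RE-CUT RIGHT (3.43) MEMBER IS BELOW THE PARENT's `constH313`**: C_L + κ·Bx·B₃·c + (Bx + θ′A₃c)(B₃(B₃A₁c)c)c ≦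
`constH313 C_L′ θ″ A₁′ A₃′ B₃ Bd′ Bq′ κ′ c` whenever C_L ≦ C_L′, θ′ ≦ θ″, A₁ ≦ A₁′, A₃ ≦ A₃′, Bx ≦ Bd′, Bx ≦ Bq′, κ ≦ κ′ (non-negative data) — the
parent's summand θ′(A₃B₃c)c is simply dropped; so the uniformised (3.43) constant of the leaves (`Cu β`) dominates the re-cut member unchanged.
[cite: Balaban1985BackgroundPropagators, Thm 3.13 p.426 (bookkeeping)] -/
theorem constHR313c_le_constH313 {CL CL' θ' θ'' A₁ A₁' A₃ A₃' B₃ Bx Bd' Bq' κ κ' c : ℝ} (hL' : CL ≤ CL') (hθ : 0 ≤ θ') (hθ'' : θ' ≤ θ'')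
    (h₁ : 0 ≤ A₁) (h₁' : A₁ ≤ A₁') (h₃ : 0 ≤ A₃) (h₃' : A₃ ≤ A₃') (hB : 0 ≤ B₃) (hx : 0 ≤ Bx) (hxd : Bx ≤ Bd') (hxq : Bx ≤ Bq')
    (hκ : 0 ≤ κ) (hκ' : κ ≤ κ') (hc : 0 ≤ c) :
    CL + κ * Bx * B₃ * c + (Bx + θ' * A₃ * c) * (B₃ * (B₃ * A₁ * c) * c) * c ≤ constH313 CL' θ'' A₁' A₃' B₃ Bd' Bq' κ' c := by
  unfold constH313
  have hθ''0 : 0 ≤ θ'' := hθ.trans hθ''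
  have hA₁'0 : 0 ≤ A₁' := h₁.trans h₁'
  have hA₃'0 : 0 ≤ A₃' := h₃.trans h₃'
  have hd'0 : 0 ≤ Bd' := hx.trans hxd
  have hq'0 : 0 ≤ Bq' := hx.trans hxq
  have hκ'0 : 0 ≤ κ' := hκ.trans hκ'
  have e2 : κ * Bx * B₃ * c ≤ κ' * Bd' * B₃ * c := by gcongr
  have e3 : 0 ≤ θ'' * (A₃' * B₃ * c) * c := by positivity
  have e4 : Bx * (B₃ * (B₃ * A₁ * c) * c) * c ≤ Bq' * (B₃ * (B₃ * A₁' * c) * c) * c := by gcongr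
  have e5 : θ' * A₃ * c * (B₃ * (B₃ * A₁ * c) * c) * c ≤ θ'' * (A₃' * (B₃ * (B₃ * A₁' * c) * c) * c) * c := by
    have h : θ' * A₃ * c * (B₃ * (B₃ * A₁ * c) * c) * c = θ' * (A₃ * (B₃ * (B₃ * A₁ * c) * c) * c) * c := by ring
    rw [h]; gcongr
  nlinarith [e2, e3, e4, e5]

omit [Fintype P] in
/-- ★ **THEOREM 3.13, THE RIGHT (3.43) MEMBER Φ^X_β∘𝔊∘∇\*_U OVER THE CUT RECORDS** — ✓`B9Thm313WholeProbe43RHolderCut.GG_probe43R_holderCut_of_letters`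
fed with `Letters313Zc.gQs1 ∕ c1_1 ∕ q1 ∕ gXH` (B_X = B₃) and `Letters313HZc.pXQs ∕ pWE` (B_WE = Bx): Φ^X_β∘𝔊∘∇\*_U has the two-space majorant
C·(Lʲη)^{1−β}e^{−ρ′d}, C = (Bh + θ_HA₁c) + κ_{XH}·Bx·B₃·c + (Bx + θ_HA₃c)(B₃(B₃A₁c)c)c (A₁ = B₀(1−θc)⁻¹, A₃ = B₃(1−θc)⁻¹), for every ρ′ ≧ 0 with
ρ′ + 3σ ≦ ρ (ρ ≦ δ₀, ρ ≦ δ₃, ρ + σ ≦ δ_K); the statement shape of `B9Thm313WholeHolderZ.GG_probe43R_of_lettersZ` over the cut records (NO `rgd1`, NO `pXDv`).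
[cite: Balaban1985BackgroundPropagators, Thm 3.13 p.426 + (3.152)–(3.153) p.426 + (3.138) p.423 + (3.43)–(3.45) p.398; Balaban1984PropagatorsII, (2.52)–(2.56) pp.232–233 + Lemma 2.1 (2.61) p.234] -/
theorem GG_probe43R_of_lettersZc (hG : GeoOK g) {𝔬 : Ops g B X Y Z W} (𝔭 : HolderProbes g B X Y PX PY) {U : B.Cfg}
    {bW : BlockNorm (toB6 g R₀ H₀) (W → ℝ)} {BhD Bx : ℝ → ℝ}
    {θ θH B₀ B₃ Bh β δ₀ δ₃ δK ρ ρ' σ c : ℝ} (hrow : RowSum (toB6 g R₀ H₀) σ c) (hc : 0 ≤ c)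
    (hθ : 0 ≤ θ) (hθH : 0 ≤ θH) (hB₀ : 0 ≤ B₀) (hB₃ : 0 ≤ B₃) (hBh : 0 ≤ Bh) (hBx : 0 ≤ Bx β) (hβ0 : 0 ≤ β) (hβ1 : β < 1)
    (hσ : 0 ≤ σ) (hρ' : 0 ≤ ρ') (hρ'ρ : ρ' + 3 * σ ≤ ρ) (hρS : ρ ≤ δ₀) (hρ₃ : ρ ≤ δ₃) (hρδ : ρ + σ ≤ δK) (hq : θ * c < 1)
    (hK : HasMaj (cNorm R₀ H₀ 𝔬.blk hG.lenle 1) (cNorm R₀ H₀ 𝔬.blk hG.lenle 1) (𝔬.G0 U ∘ₗ (𝔬.Tpi U + 𝔬.T2 U))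
      (fun a b => θ * Real.exp (-(δK * g.dist a b))))
    (he2 : HasMajorantHom (g := toB6 g R₀ H₀) 𝔬.blkY 𝔬.blk (𝔬.G0 U ∘ₗ 𝔬.Dstar U)
      (fun a b => B₀ * g.len a * Real.exp (-(δ₀ * g.dist a b))))
    (h43 : HasMajorantHom (g := toB6 g R₀ H₀) 𝔬.blkY 𝔭.blkPX (𝔭.ΦX U β ∘ₗ (𝔬.G0 U ∘ₗ 𝔬.Dstar U))
      (fun (a b : g.Site) => Bh * g.len a ^ (1 - β) * Real.exp (-(δ₀ * g.dist a b))))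
    (hpX : HasMaj (cNormR R₀ H₀ 𝔬.blk hG.lenle (-1)) (cNormR R₀ H₀ 𝔭.blkPX hG.lenle (β - 1))
      ((𝔭.ΦX U β ∘ₗ 𝔬.G0 U) ∘ₗ (𝔬.Tpi U + 𝔬.T2 U)) (fun a b => θH * Real.exp (-(δK * g.dist a b))))
    {wZ : g.Site → ℝ} {hwZ : ∀ y, 0 < wZ y}
    {Gp : B.Cfg → Module.End ℝ (W → ℝ)} {bXH : BlockNorm (toB6 g R₀ H₀) (X → ℝ)}
    (hL : Letters313Zc 𝔬 Gp R₀ H₀ hG wZ hwZ B₃ δ₃ bXH U) (hH3 : Letters313HZc 𝔬 𝔭 Gp R₀ H₀ hG wZ hwZ bW BhD Bx δ₃ bXH U)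
    (hI : Identities 𝔬 U) (h152 : Ids3152 𝔬 Gp U) :
    HasMajorantHom (g := toB6 g R₀ H₀) 𝔬.blkY 𝔭.blkPX (𝔭.ΦX U β ∘ₗ (𝔬.GG U ∘ₗ 𝔬.Dstar U))
      (fun (a b : g.Site) => ((Bh + θH * (B₀ * (1 - θ * c)⁻¹) * c) + bXH.κ * Bx β * B₃ * c +
          (Bx β + θH * (B₃ * (1 - θ * c)⁻¹) * c) * (B₃ * (B₃ * (B₀ * (1 - θ * c)⁻¹) * c) * c) * c) *
        g.len a ^ (1 - β) * Real.exp (-(ρ' * g.dist a b))) :=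
  GG_probe43R_holderCut_of_letters (hwZ := hwZ) hG 𝔭 hrow hc hθ hθH hB₀ hB₃ hBh hBx hB₃ hBx hσ hρ' hρ'ρ hρS hρ₃ hρδ hq hK he2 h43 hpX
    (hH3.pXQs β hβ0 hβ1) hL.gQs1 hL.c1_1 hL.q1 hL.gXH (hH3.pWE β hβ0 hβ1) hI h152

/-! ## §3 The pair families (3.46)₄, (3.46)₅ of 𝔊 over the cut pair record -/

omit [Fintype PX] [Fintype PY] in
/-- ★ **(3.46)₄ FOR 𝔊 AS THE PACKAGED PAIR FAMILY ∇_{U,ν}∇_{U,μ}𝔊 OVER THE CUT PAIR RECORD** — ✓`B9Thm313WholeL2DerivCut.GG_l2bd_family3DerivCut` fed with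
`Letters313L2Pc.gQs ∕ c1 ∕ q ∕ ddGQs ∕ vDRDG` (NO `ddGDv`); conclusion VERBATIM that of `B9Thm313WholeDirL2Z.GG_l2bd_family3Z`.
[cite: Balaban1985BackgroundPropagators, Thm 3.13 p.426 + (3.153) p.426 + (3.46) p.398 + (3.39) p.397; Balaban1984PropagatorsII, Lemma 2.1 (2.60)–(2.61) p.234] -/
theorem GG_l2bd_family3Zc (hG : GeoOK g) {𝔬 : Ops g B X Y Z W} {Dd Dds : B.Cfg → P → Module.End ℝ (X → ℝ)} {U : B.Cfg}
    {B₂ B₄ θ δ ρ ρ₀ α Λ σ c : ℝ} (hrow : RowSum (toB6 g R₀ H₀) σ c) (hB₂ : 0 ≤ B₂) (hB₄ : 0 ≤ B₄) (hθ : 0 ≤ θ) (hρ : 0 ≤ ρ)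
    (hσ : 0 ≤ σ) (hρδ : ρ + 5 * σ ≤ δ) (hΛ : 0 ≤ Λ) (hST : ScaleTransfer g ρ₀ α Λ (fun y => g.len y ^ (1 : ℝ)))
    (hL : Thm33G0L2P 𝔬 Dd Dds R₀ H₀ B₂ δ U)
    (hT : BlockBd (g := toB6 g R₀ H₀) 𝔬.blk 𝔬.blk (𝔬.Tpi U + 𝔬.T2 U)
      (fun (y y' : g.Site) => θ * (g.len y)⁻¹ * (g.len y')⁻¹ * Real.exp (-(δ * g.dist y y'))))
    {vZ : g.Site → ℝ} {hvZ : ∀ y, 0 < vZ y} (hLt : Letters313L2Pc 𝔬 Dd Dds R₀ H₀ B₄ δ vZ hvZ U) (hI : Identities 𝔬 U)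
    (hq : B₂ * θ * c * c < 1) :
    BlockBd (g := toB6 g R₀ H₀) 𝔬.blk (𝔬.blk ∘ Prod.fst) (familyOp (fun q : P × P => (Dd U q.1 ∘ₗ Dd U q.2) ∘ₗ 𝔬.GG U))
      (fun (y y' : g.Site) => Real.sqrt (Fintype.card (P × P)) * (constG46 (constKp B₂ B₄ θ c) c * Λ *
        Real.exp (-((ρ - α * ρ₀) * g.dist y y')))) :=
  GG_l2bd_family3DerivCut hG hrow hB₂ hB₄ hθ hρ hσ hρδ hΛ hST hL hT hvZ hLt.gQs hLt.c1 hLt.q hLt.ddGQs hLt.vDRDG hI hq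

omit [Fintype PX] [Fintype PY] in
/-- ★ **(3.46)₅ FOR 𝔊 AS THE PACKAGED PAIR FAMILY 𝔊∇\*_{U,ν}∇\*_{U,μ} OVER THE CUT PAIR RECORD** — ✓`B9Thm313WholeL2DerivCut.GG_l2bd_family5DerivCut` fed with
`Letters313L2Pc.gQs ∕ c1 ∕ q ∕ vGDRD` (NO `rgdDds`); conclusion VERBATIM that of `B9Thm313WholeDirL2Z.GG_l2bd_family5Z`.
[cite: Balaban1985BackgroundPropagators, Thm 3.13 p.426 + (3.153) p.426 + (3.46) p.398 + (3.39) p.397; Balaban1984PropagatorsII, Lemma 2.1 (2.60)–(2.61) p.234] -/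
theorem GG_l2bd_family5Zc (hG : GeoOK g) {𝔬 : Ops g B X Y Z W} {Dd Dds : B.Cfg → P → Module.End ℝ (X → ℝ)} {U : B.Cfg}
    {B₂ B₄ θ δ ρ ρ₀ α Λ σ c : ℝ} (hrow : RowSum (toB6 g R₀ H₀) σ c) (hB₂ : 0 ≤ B₂) (hB₄ : 0 ≤ B₄) (hθ : 0 ≤ θ) (hρ : 0 ≤ ρ)
    (hσ : 0 ≤ σ) (hρδ : ρ + 5 * σ ≤ δ) (hΛ : 0 ≤ Λ) (hST : ScaleTransfer g ρ₀ α Λ (fun y => g.len y ^ (-1 : ℝ)))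
    (hL : Thm33G0L2P 𝔬 Dd Dds R₀ H₀ B₂ δ U)
    (hT : BlockBd (g := toB6 g R₀ H₀) 𝔬.blk 𝔬.blk (𝔬.Tpi U + 𝔬.T2 U)
      (fun (y y' : g.Site) => θ * (g.len y)⁻¹ * (g.len y')⁻¹ * Real.exp (-(δ * g.dist y y'))))
    {vZ : g.Site → ℝ} {hvZ : ∀ y, 0 < vZ y} (hLt : Letters313L2Pc 𝔬 Dd Dds R₀ H₀ B₄ δ vZ hvZ U) (hI : Identities 𝔬 U)
    (hq : B₂ * θ * c * c < 1) :
    BlockBd (g := toB6 g R₀ H₀) 𝔬.blk (𝔬.blk ∘ Prod.fst) (familyOp (fun q : P × P => 𝔬.GG U ∘ₗ (Dds U q.1 ∘ₗ Dds U q.2)))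
      (fun (y y' : g.Site) => Real.sqrt (Fintype.card (P × P)) * (constG46 (constKp B₂ B₄ θ c) c * Λ *
        Real.exp (-((ρ - α * ρ₀) * g.dist y y')))) :=
  GG_l2bd_family5DerivCut hG hrow hB₂ hB₄ hθ hρ hσ hρδ hΛ hST hL hT hvZ hLt.gQs hLt.c1 hLt.q hLt.vGDRD hI hq

end OneMember

end

end Literature.MathematicalPhysics.QuantumFieldTheory.Balaban1983to89.B9Thm313WholeCutCores
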